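import Mathlib
import HarnessLib
import Literature.MathematicalPhysics.QuantumLattice.HubbardGridCounterQuadratic
import Summits.HubbardSuperconductivity.HubbardSuperconductivity.Theorems.KLProgrammeKLRegimeSplitFlowPieceOscWiener
import Summits.HubbardSuperconductivity.HubbardSuperconductivity.Theorems.KLProgrammeKLRegimeTwoVolumeGridGluing

/-!
# Route `KLProgramme` — crux K3, VL child `KLRegimeVolumeLimitV17F2` (stmt-HubbardSuperconductivity-20440), (vi) scale-`0` base (blueprint v4 M4):
# THE TWO-VOLUME GLUING DEFECT OF THE GRID COUNTERTERM `𝒩_{K,N}` — bounded everywhere, and the frame-mismatch part ONLY away from block boundaries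
# (cell gate-hubbard-kl, seat hubbard-kl-k3c4-p1 g11; `--supports` stmt-…-20440)

In the own-top-frame organisation of the two-volume induction the scale-`0` input of the STEP is the grid action `V_N + 𝒩_{K_V,N}` of each volume
`V ∈ {L, L″ = bL}` at its own top flow frame `K_V`.  The on-site quartic glues EXACTLY (`…TwoVolumeGridGluing.sum_map_blockEmb_hubbardGridInteraction`);
the counterterm — a time-local hopping with the finite-range position kernel `Ǩ_V = framePosKernel V K` (`HubbardGridCounterQuadratic`) — does NOT:
its fine copy hops across block boundaries where the glued coarse copies wrap around inside their blocks.  This file is the input defect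
`D := 𝒩_{K″,L″,N} − Σ_β (𝒩_{K,L,N} ∘ f_β)` of the scale-`0` STEP (`hNDj` / `hEj` of `…TwoVolumeScaleSucc`):

* §1 `sum_norm_kernel_two_structured_le_at` — the per-pin form of `sum_norm_kernel_two_structured_le` (coefficient sums at ONE pin);
* §2 linearity in the frame: `hubbardGridCounterQuadratic_fsub` (`𝒩_{A ⊖ B} = 𝒩_A − 𝒩_B`, on r2d-p1's `KLRegimeSplit.framePosKernel_fsub`);
* §3 the glued counterterm as a structured quadratic sum (`sum_map_blockEmb_hubbardGridCounterQuadratic_eq`) and its pinned coefficient sums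
  (`≤ (|β|/N)·coeffNorm 0 K` at every fine pin, both slots);
* §4 **`sum_norm_kernel_counterGlueDefect_le`** — EVERYWHERE: `Σ_{Y : Y p = w} ‖kernel D 2 Y‖ ≤ (|β|/N)·(coeffNorm 0 K″ + coeffNorm 0 K)`, every pin,
  both slots, every `L, L″, N` (degrees `≠ 2` vanish: `kernel_counterGlueDefect_of_ne`);
* the DEEP-pin arithmetic (fine hoppings from a deep site are the glued hoppings) is the companion `…TwoVolumeGridCounterGluingArith`; with §1/§2 it gives
  the vanishing of `D − 𝒩_{K″ ⊖ K, L″, N}` at pins deeper than `K.degree` (the `hEj` input) — next file.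

Everything is proved; no definition.  References: BGM 2003 §1.2 (2.10) (the counterterm); Salmhofer 1999 §4.2.4 (time-lattice action), §4.3 (finite-volume
bookkeeping).
-/

noncomputable section

namespace Summit.HubbardSuperconductivity.HubbardSuperconductivity.Theorems.TwoVolumeDefect

set_option linter.dupNamespace false -- summit = problem name (single-conjunct summit), D-0017

open Finset Literature.MathematicalPhysics.QuantumLattice GrassmannAlgebra Literature.Probability.LatticeModels
open Summit.HubbardSuperconductivity.HubbardSuperconductivity.Theorems.KLRegimeSplit
/-! ## §1 The per-pin structured bound -/

section Structured

variable {Γ : Type*} [DecidableEq Γ] [Fintype Γ]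

/-- The pinned count of one ordered pair: `Σ_{Y : Y p = w} [Y = v] = [v p = w]` (local copy of the private helper of
`HubbardGridCounterQuadratic`). [folklore] -/
private theorem sum_filter_ite_eq_vec' (p : Fin 2) (w : Γ) (v : Fin 2 → Γ) :
    ∑ Y ∈ univ.filter (fun Y : Fin 2 → Γ => Y p = w), (if Y = v then (1 : ℝ) else 0) = if v p = w then 1 else 0 := by
  rw [sum_ite_eq' (univ.filter fun Y : Fin 2 → Γ => Y p = w) v (fun _ => (1 : ℝ))]
  simp only [mem_filter, mem_univ, true_and]

/-- **Pinned `ℓ¹` sums of the `2`-point kernel of a structured quadratic polynomial, AT ONE PIN**: if the coefficients with `a_i = w` and those with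
`b_i = w` each have total size `≤ B`, then `Σ_{Y : Y p = w} ‖kernel Q 2 Y‖ ≤ B` for both slots `p` (the per-pin form of
`sum_norm_kernel_two_structured_le`). [folklore] -/
theorem sum_norm_kernel_two_structured_le_at {ι : Type*} (s : Finset ι) (c : ι → ℂ) (a b : ι → Γ) (w : Γ) {B : ℝ}
    (ha : ∑ i ∈ s.filter (fun i => a i = w), ‖c i‖ ≤ B) (hb : ∑ i ∈ s.filter (fun i => b i = w), ‖c i‖ ≤ B) (p : Fin 2) :
    ∑ Y ∈ univ.filter (fun Y : Fin 2 → Γ => Y p = w), ‖kernel ℂ (∑ i ∈ s, c i • (gen ℂ (a i) * gen ℂ (b i))) 2 Y‖ ≤ B := by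
  have hpt : ∀ Y : Fin 2 → Γ, ‖kernel ℂ (∑ i ∈ s, c i • (gen ℂ (a i) * gen ℂ (b i))) 2 Y‖ ≤
      ∑ i ∈ s, ‖c i‖ * (2⁻¹ * ((if Y = ![a i, b i] then (1 : ℝ) else 0) + (if Y = ![b i, a i] then (1 : ℝ) else 0))) := by
    intro Y
    rw [kernel_sum]
    refine (norm_sum_le _ _).trans (sum_le_sum fun i _ => ?_)
    rw [kernel_smul, norm_mul]
    exact mul_le_mul_of_nonneg_left (norm_kernel_two_gen_mul_gen_le (a i) (b i) Y) (norm_nonneg _)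
  calc ∑ Y ∈ univ.filter (fun Y : Fin 2 → Γ => Y p = w), ‖kernel ℂ (∑ i ∈ s, c i • (gen ℂ (a i) * gen ℂ (b i))) 2 Y‖
      ≤ ∑ Y ∈ univ.filter (fun Y : Fin 2 → Γ => Y p = w),
          ∑ i ∈ s, ‖c i‖ * (2⁻¹ * ((if Y = ![a i, b i] then (1 : ℝ) else 0) + (if Y = ![b i, a i] then (1 : ℝ) else 0))) :=
        sum_le_sum fun Y _ => hpt Y
    _ = ∑ i ∈ s, ‖c i‖ * (2⁻¹ * ((if ![a i, b i] p = w then (1 : ℝ) else 0) + (if ![b i, a i] p = w then (1 : ℝ) else 0))) := by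
        rw [sum_comm]
        refine sum_congr rfl fun i _ => ?_
        rw [← mul_sum, ← mul_sum, sum_add_distrib, sum_filter_ite_eq_vec', sum_filter_ite_eq_vec']
    _ = 2⁻¹ * (∑ i ∈ s.filter (fun i => ![a i, b i] p = w), ‖c i‖ + ∑ i ∈ s.filter (fun i => ![b i, a i] p = w), ‖c i‖) := by
        rw [sum_filter, sum_filter, ← sum_add_distrib, mul_sum]
        refine sum_congr rfl fun i _ => ?_
        split_ifs <;> ring
    _ ≤ 2⁻¹ * (B + B) := by
        refine mul_le_mul_of_nonneg_left (add_le_add ?_ ?_) (by norm_num)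
        · fin_cases p
          · calc ∑ i ∈ s.filter (fun i => ![a i, b i] (⟨0, by norm_num⟩ : Fin 2) = w), ‖c i‖
                = ∑ i ∈ s.filter (fun i => a i = w), ‖c i‖ := by congr 1
              _ ≤ B := ha
          · calc ∑ i ∈ s.filter (fun i => ![a i, b i] (⟨1, by norm_num⟩ : Fin 2) = w), ‖c i‖
                = ∑ i ∈ s.filter (fun i => b i = w), ‖c i‖ := by congr 1
              _ ≤ B := hb
        · fin_cases p
          · calc ∑ i ∈ s.filter (fun i => ![b i, a i] (⟨0, by norm_num⟩ : Fin 2) = w), ‖c i‖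
                = ∑ i ∈ s.filter (fun i => b i = w), ‖c i‖ := by congr 1
              _ ≤ B := hb
          · calc ∑ i ∈ s.filter (fun i => ![b i, a i] (⟨1, by norm_num⟩ : Fin 2) = w), ‖c i‖
                = ∑ i ∈ s.filter (fun i => a i = w), ‖c i‖ := by congr 1
              _ ≤ B := ha
    _ = B := by ring

end Structured

/-! ## §2 Linearity of the counterterm in the frame -/

section Linear

variable {L N : ℕ} [NeZero L]

/-- **`𝒩_{A ⊖ B, N} = 𝒩_{A,N} − 𝒩_{B,N}`**: the grid counterterm is additive in the frame (`KLRegimeSplit.framePosKernel_fsub`, r2d-p1). [folklore] -/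
theorem hubbardGridCounterQuadratic_fsub (β : ℝ) (A B : TrigPolyC4v) :
    hubbardGridCounterQuadratic L N β (fsub A B) = hubbardGridCounterQuadratic L N β A - hubbardGridCounterQuadratic L N β B := by
  simp only [hubbardGridCounterQuadratic, framePosKernel_fsub, sub_smul, sum_sub_distrib, smul_sub]

end Linear

/-! ## §3 The glued counterterm as a structured quadratic sum, and its pinned coefficient sums -/

section Glue

variable {b L Lf N : ℕ} [NeZero Lf] [NeZero L]
  (e : GridLeg (GridPoint Lf N) ≃ (Fin 2 → Fin b) × GridLeg (GridPoint L N))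
  (Fe : (Fin 2 → Fin b) → (GridLeg (GridPoint L N) → ℂ) →ₗ[ℂ] (GridLeg (GridPoint Lf N) → ℂ))
  (hFe : ∀ β v X', Fe β v X' = if (e X').1 = β then v (e X').2 else 0)
include hFe

/-- **The glued coarse counterterm is a structured quadratic sum** over `(block, spin, point, site)`: the copy in block `β` of the monomial
`Ǩ_L(x⃗ − y⃗) ψ⁺_{((j,x⃗),σ)} ψ⁻_{((j,y⃗),σ)}` is the same coefficient on the lifted legs `e⁻¹(β, ·)`. [folklore] -/
theorem sum_map_blockEmb_hubbardGridCounterQuadratic_eq (β' : ℝ) (K : TrigPolyC4v) :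
    ∑ β, ExteriorAlgebra.map (Fe β) (hubbardGridCounterQuadratic L N β' K) =
      ∑ j : (Fin 2 → Fin b) × (Fin 2 × (GridPoint L N × TorusSite 2 L)),
        ((((β' / N : ℝ)) : ℂ) * framePosKernel L K (j.2.2.1.2 - j.2.2.2)) •
          (gen ℂ (e.symm (j.1, (((j.2.2.1, j.2.1), 0) : GridLeg (GridPoint L N)))) *
            gen ℂ (e.symm (j.1, ((((j.2.2.1.1, j.2.2.2), j.2.1), 1) : GridLeg (GridPoint L N))))) := by
  rw [Fintype.sum_prod_type]
  refine sum_congr rfl fun β _ => ?_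
  rw [hubbardGridCounterQuadratic_eq_sum, map_sum]
  refine sum_congr rfl fun i _ => ?_
  rw [map_smul, map_mul, map_blockEmb_gen e (hFe β), map_blockEmb_gen e (hFe β)]

omit [NeZero Lf] hFe in
/-- **The `ψ⁺`-pinned coefficient sum of the glued counterterm at a fine pin** is the coarse one at the projected pin:
`≤ (|β|/N)·coeffNorm 0 K`. [folklore] -/
theorem sum_filter_plusLeg_norm_coeff_glue_le (β' : ℝ) (K : TrigPolyC4v) (w : GridLeg (GridPoint Lf N)) :
    ∑ j ∈ (univ : Finset ((Fin 2 → Fin b) × (Fin 2 × (GridPoint L N × TorusSite 2 L)))).filter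
        (fun j => e.symm (j.1, (((j.2.2.1, j.2.1), 0) : GridLeg (GridPoint L N))) = w),
      ‖(((β' / N : ℝ)) : ℂ) * framePosKernel L K (j.2.2.1.2 - j.2.2.2)‖ ≤ |β'| / N * K.coeffNorm 0 := by
  classical
  set A : Fin 2 × (GridPoint L N × TorusSite 2 L) → GridLeg (GridPoint L N) := fun i => ((i.2.1, i.1), 0) with hA
  have hset : (univ : Finset ((Fin 2 → Fin b) × (Fin 2 × (GridPoint L N × TorusSite 2 L)))).filter
      (fun j => e.symm (j.1, A j.2) = w) =
      ((univ : Finset (Fin 2 × (GridPoint L N × TorusSite 2 L))).filter (fun i => A i = (e w).2)).map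
        ⟨fun i => ((e w).1, i), fun i i' h => (Prod.ext_iff.1 h).2⟩ := by
    ext j
    simp only [mem_filter, mem_univ, true_and, mem_map, Function.Embedding.coeFn_mk]
    constructor
    · intro h
      have h' : (j.1, A j.2) = e w := by rw [← h, Equiv.apply_symm_apply]
      refine ⟨j.2, by rw [← h'], ?_⟩
      rw [← h']
    · rintro ⟨i, hi, rfl⟩
      show e.symm ((e w).1, A i) = w
      rw [hi, Prod.mk.eta, Equiv.symm_apply_apply]
  rw [hset, sum_map]
  exact sum_filter_plusLeg_norm_coeff_le β' K (e w).2

omit [NeZero Lf] hFe in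
/-- **The `ψ⁻`-pinned coefficient sum of the glued counterterm at a fine pin**: `≤ (|β|/N)·coeffNorm 0 K`. [folklore] -/
theorem sum_filter_minusLeg_norm_coeff_glue_le (β' : ℝ) (K : TrigPolyC4v) (w : GridLeg (GridPoint Lf N)) :
    ∑ j ∈ (univ : Finset ((Fin 2 → Fin b) × (Fin 2 × (GridPoint L N × TorusSite 2 L)))).filter
        (fun j => e.symm (j.1, ((((j.2.2.1.1, j.2.2.2), j.2.1), 1) : GridLeg (GridPoint L N))) = w),
      ‖(((β' / N : ℝ)) : ℂ) * framePosKernel L K (j.2.2.1.2 - j.2.2.2)‖ ≤ |β'| / N * K.coeffNorm 0 := by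
  classical
  set Bm : Fin 2 × (GridPoint L N × TorusSite 2 L) → GridLeg (GridPoint L N) := fun i => (((i.2.1.1, i.2.2), i.1), 1) with hBm
  have hset : (univ : Finset ((Fin 2 → Fin b) × (Fin 2 × (GridPoint L N × TorusSite 2 L)))).filter
      (fun j => e.symm (j.1, Bm j.2) = w) =
      ((univ : Finset (Fin 2 × (GridPoint L N × TorusSite 2 L))).filter (fun i => Bm i = (e w).2)).map
        ⟨fun i => ((e w).1, i), fun i i' h => (Prod.ext_iff.1 h).2⟩ := by
    ext j
    simp only [mem_filter, mem_univ, true_and, mem_map, Function.Embedding.coeFn_mk]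
    constructor
    · intro h
      have h' : (j.1, Bm j.2) = e w := by rw [← h, Equiv.apply_symm_apply]
      refine ⟨j.2, by rw [← h'], ?_⟩
      rw [← h']
    · rintro ⟨i, hi, rfl⟩
      show e.symm ((e w).1, Bm i) = w
      rw [hi, Prod.mk.eta, Equiv.symm_apply_apply]
  rw [hset, sum_map]
  exact sum_filter_minusLeg_norm_coeff_le β' K (e w).2

/-- **The pinned profile of the glued counterterm**: `Σ_{Y : Y p = w} ‖kernel (Σ_β 𝒩_{K,L,N} ∘ f_β) 2 Y‖ ≤ (|β|/N)·coeffNorm 0 K` at every fine pin, both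
slots. [folklore] -/
theorem sum_norm_kernel_glue_hubbardGridCounterQuadratic_le (β' : ℝ) (K : TrigPolyC4v) (p : Fin 2) (w : GridLeg (GridPoint Lf N)) :
    ∑ Y ∈ univ.filter (fun Y : Fin 2 → GridLeg (GridPoint Lf N) => Y p = w),
      ‖kernel ℂ (∑ β, ExteriorAlgebra.map (Fe β) (hubbardGridCounterQuadratic L N β' K)) 2 Y‖ ≤ |β'| / N * K.coeffNorm 0 := by
  classical
  rw [sum_map_blockEmb_hubbardGridCounterQuadratic_eq e Fe hFe]
  exact sum_norm_kernel_two_structured_le univ _ _ _ (sum_filter_plusLeg_norm_coeff_glue_le e β' K)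
    (sum_filter_minusLeg_norm_coeff_glue_le e β' K) p w

/-- The glued counterterm has kernels only in degree `2`. [folklore] -/
theorem kernel_glue_hubbardGridCounterQuadratic_of_ne (β' : ℝ) (K : TrigPolyC4v) {m : ℕ} (hm : m ≠ 2)
    (Y : Fin m → GridLeg (GridPoint Lf N)) :
    kernel ℂ (∑ β, ExteriorAlgebra.map (Fe β) (hubbardGridCounterQuadratic L N β' K)) m Y = 0 := by
  classical
  rw [sum_map_blockEmb_hubbardGridCounterQuadratic_eq e Fe hFe]
  exact kernel_two_structured_of_ne univ _ _ _ hm Y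

/-! ## §4 The gluing defect of the counterterm: everywhere bounds -/

/-- **The two-volume input defect of the grid action is the counterterm's**: the quartic glues exactly. [folklore] -/
theorem gridAction_sub_glue_eq (he1 : ∀ X' i, ((e X').1 i : ℕ) = (X'.1.1.2 i).val / L)
    (he2 : ∀ X', (e X').2 = (((X'.1.1.1, fun i => (((X'.1.1.2 i).val : ℕ) : ZMod L)), X'.1.2), X'.2))
    (β' U : ℝ) (K K'' : TrigPolyC4v) :
    (hubbardGridInteraction Lf N β' U + hubbardGridCounterQuadratic Lf N β' K'') -
        ∑ β, ExteriorAlgebra.map (Fe β) (hubbardGridInteraction L N β' U + hubbardGridCounterQuadratic L N β' K) =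
      hubbardGridCounterQuadratic Lf N β' K'' - ∑ β, ExteriorAlgebra.map (Fe β) (hubbardGridCounterQuadratic L N β' K) := by
  simp only [map_add, sum_add_distrib, sum_map_blockEmb_hubbardGridInteraction e he1 he2 Fe hFe]
  abel

/-- **THE COUNTERTERM GLUING DEFECT IS BOUNDED EVERYWHERE**: for `D := 𝒩_{K″,L″,N} − Σ_β (𝒩_{K,L,N} ∘ f_β)`, at every fine pin and both slots,
`Σ_{Y : Y p = w} ‖kernel D 2 Y‖ ≤ (|β|/N)·(coeffNorm 0 K″ + coeffNorm 0 K)` (every `L, L″, N`; the `hNDj` input of the scale-`0` STEP). [folklore] -/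
theorem sum_norm_kernel_counterGlueDefect_le (β' : ℝ) (K K'' : TrigPolyC4v) (p : Fin 2) (w : GridLeg (GridPoint Lf N)) :
    ∑ Y ∈ univ.filter (fun Y : Fin 2 → GridLeg (GridPoint Lf N) => Y p = w),
      ‖kernel ℂ (hubbardGridCounterQuadratic Lf N β' K'' - ∑ β, ExteriorAlgebra.map (Fe β) (hubbardGridCounterQuadratic L N β' K)) 2 Y‖ ≤
        |β'| / N * (K''.coeffNorm 0 + K.coeffNorm 0) := by
  classical
  calc ∑ Y ∈ univ.filter (fun Y : Fin 2 → GridLeg (GridPoint Lf N) => Y p = w),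
        ‖kernel ℂ (hubbardGridCounterQuadratic Lf N β' K'' - ∑ β, ExteriorAlgebra.map (Fe β) (hubbardGridCounterQuadratic L N β' K)) 2 Y‖
      ≤ ∑ Y ∈ univ.filter (fun Y : Fin 2 → GridLeg (GridPoint Lf N) => Y p = w),
          (‖kernel ℂ (hubbardGridCounterQuadratic Lf N β' K'') 2 Y‖ +
            ‖kernel ℂ (∑ β, ExteriorAlgebra.map (Fe β) (hubbardGridCounterQuadratic L N β' K)) 2 Y‖) := by
        refine sum_le_sum fun Y _ => ?_
        rw [sub_eq_add_neg, kernel_add, ← neg_one_smul ℂ (∑ β, ExteriorAlgebra.map (Fe β) (hubbardGridCounterQuadratic L N β' K)),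
          kernel_smul, neg_one_mul]
        exact norm_add_le_of_le le_rfl (by rw [norm_neg])
    _ ≤ |β'| / N * K''.coeffNorm 0 + |β'| / N * K.coeffNorm 0 := by
        rw [sum_add_distrib]
        exact add_le_add (sum_norm_kernel_hubbardGridCounterQuadratic_le β' K'' p w)
          (sum_norm_kernel_glue_hubbardGridCounterQuadratic_le e Fe hFe β' K p w)
    _ = |β'| / N * (K''.coeffNorm 0 + K.coeffNorm 0) := by ring

/-- The counterterm gluing defect has kernels only in degree `2`. [folklore] -/
theorem kernel_counterGlueDefect_of_ne (β' : ℝ) (K K'' : TrigPolyC4v) {m : ℕ} (hm : m ≠ 2) (Y : Fin m → GridLeg (GridPoint Lf N)) :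
    kernel ℂ (hubbardGridCounterQuadratic Lf N β' K'' - ∑ β, ExteriorAlgebra.map (Fe β) (hubbardGridCounterQuadratic L N β' K)) m Y = 0 := by
  rw [sub_eq_add_neg, kernel_add, ← neg_one_smul ℂ (∑ β, ExteriorAlgebra.map (Fe β) (hubbardGridCounterQuadratic L N β' K)), kernel_smul,
    kernel_hubbardGridCounterQuadratic_of_ne β' K'' hm, kernel_glue_hubbardGridCounterQuadratic_of_ne e Fe hFe β' K hm, mul_zero, add_zero]

end Glue


end Summit.HubbardSuperconductivity.HubbardSuperconductivity.Theorems.TwoVolumeDefect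

end
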